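import Mathlib
import Summits.ResolutionOfSingularities.ResolutionOfSingularities.Theorems.SyzygyFlatteningDefs
import Literature.AlgebraicGeometry.Resolution.RegularLocalRingsProofs
import Literature.AlgebraicGeometry.Resolution.RegularLocalRingsNormal
import HarnessLib

/-!
# Regular stages are fixed points of the syzygy-flattening operator

Crux `HigherRankTermination` (stmt-ResolutionOfSingularities-17045), line `birth`, stub
`stub_regularStep`: for a stage `B ⊆ O` of the syzygy-flattening tower with `Frac B = K`,
closed under localisation at the centre of `O` (`locAt O B = B`) and regular local,
`step O B = B` where `step O B = locAt O (nrm (chart O B))`.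

Proof.
* `singIdeal B = ⊤` (`singIdeal_eq_top_of_isRegularLocalRing`): every localisation of a regular
  local ring at a prime is regular (Serre, Matsumura Thm. 19.3), so the non-regular locus is
  empty and the resolved module `B ⧸ singIdeal B` is zero.
* Every image `range (d i)` of an exact complex `⋯ → B^{b 1} → B^{b 0} → 0` of finite free
  modules over the local ring `B` is finite free (`free_range_of_exact`): split off the kernels
  inductively (`projective_ker_of_projective_range`), and finite projective over local is free.
* For a free `M` with an injective `ι : M → B^r` and an `r`-tuple `x` with `det [ι x] ≠ 0`,
  `finrank M = r` (`finrank_eq_of_injective_of_det_ne_zero`); in a basis `e : Fin r` every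
  maximal minor factors, `[ι g] = [coords g] * [ι e]` (`matrix_of_linearMap_eq_mul`).
  `O`-minimality of `x` tested against `g' = e` gives `(det [coords x])⁻¹ ∈ O`, so every
  adjoined Plücker ratio is `det [coords g] / det [coords x]`: numerator and denominator in `B`,
  the denominator inverted in `O` — an element of `locAt O B = B`
  (`chartSet_subset_of_isRegularLocalRing`). Hence `chart O B = B`.
* `nrm B = B` (`nrm_eq_self_of_isIntegrallyClosed`): a regular local ring is integrally closed
  (Matsumura Thm. 19.4) and `K = Frac B`.
* `step O B = locAt O (nrm (chart O B)) = locAt O B = B`.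
-/

noncomputable section

-- single-problem summit: the doubled namespace component `ResolutionOfSingularities` is forced
set_option linter.dupNamespace false

namespace Summit.ResolutionOfSingularities.ResolutionOfSingularities.Theorems.SyzygyFlattening

open Literature.AlgebraicGeometry.Resolution

/-! ## Module-theoretic helpers -/

/-- The kernel of a linear map out of a projective module whose range is projective is
projective: the surjection onto the range splits, so the kernel is a direct summand.
[folklore] -/
theorem projective_ker_of_projective_range {R : Type*} [Ring R] {M N : Type*}
    [AddCommGroup M] [AddCommGroup N] [Module R M] [Module R N] [Module.Projective R M]
    (f : M →ₗ[R] N) [Module.Projective R ↥(LinearMap.range f)] :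
    Module.Projective R ↥(LinearMap.ker f) := by
  obtain ⟨σ, hσ⟩ := LinearMap.exists_rightInverse_of_surjective f.rangeRestrict
    (LinearMap.range_rangeRestrict f)
  have hσ' : ∀ w : ↥(LinearMap.range f), f (σ w) = (w : N) := fun w => by
    have h := congrArg Subtype.val (LinearMap.congr_fun hσ w)
    simpa using h
  have hmem : ∀ v : M,
      ((LinearMap.id : M →ₗ[R] M) - σ ∘ₗ f.rangeRestrict) v ∈ LinearMap.ker f := by
    intro v
    simp [LinearMap.mem_ker, hσ']
  refine Module.Projective.of_split (LinearMap.ker f).subtype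
    (LinearMap.codRestrict (LinearMap.ker f)
      ((LinearMap.id : M →ₗ[R] M) - σ ∘ₗ f.rangeRestrict) hmem) ?_
  ext ⟨v, hv⟩
  have h0 : f.rangeRestrict v = 0 := by
    ext
    simpa [LinearMap.mem_ker] using hv
  simp [h0]

/-- In an exact complex `⋯ → R^{b 2} → R^{b 1} → R^{b 0}` of finite free modules with `d 0`
surjective, every image `range (d i)` is a projective `R`-module (induction on `i`, splitting off
kernels). [folklore] -/
theorem projective_range_of_exact {R : Type*} [CommRing R] (b : ℕ → ℕ)
    (d : (i : ℕ) → ((Fin (b (i + 1)) → R) →ₗ[R] (Fin (b i) → R)))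
    (h0 : LinearMap.range (d 0) = ⊤) (hd : ∀ i, Function.Exact (d (i + 1)) (d i)) (i : ℕ) :
    Module.Projective R ↥(LinearMap.range (d i)) := by
  induction i with
  | zero => exact Module.Projective.of_equiv' (LinearEquiv.ofTop _ h0).symm
  | succ i ih =>
    haveI : Module.Projective R ↥(LinearMap.ker (d i)) := projective_ker_of_projective_range (d i)
    exact Module.Projective.of_equiv' (LinearEquiv.ofEq _ _ (hd i).linearMap_ker_eq)

/-- Over a local ring, every image `range (d i)` of an exact complex
`⋯ → R^{b 2} → R^{b 1} → R^{b 0}` of finite free modules with `d 0` surjective is a (finite)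
free module: it is finite projective, and finite projective modules over local rings are free.
[folklore] -/
theorem free_range_of_exact {R : Type*} [CommRing R] [IsLocalRing R] (b : ℕ → ℕ)
    (d : (i : ℕ) → ((Fin (b (i + 1)) → R) →ₗ[R] (Fin (b i) → R)))
    (h0 : LinearMap.range (d 0) = ⊤) (hd : ∀ i, Function.Exact (d (i + 1)) (d i)) (i : ℕ) :
    Module.Free R ↥(LinearMap.range (d i)) := by
  haveI := projective_range_of_exact b d h0 hd i
  exact Module.free_of_flat_of_isLocalRing

/-- Maximal minors factor through coordinates: for a basis `e` of `M` indexed by `Fin r` and a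
linear map `ι : M → R^r`, the matrix `[ι (g i) j]` of an `r`-tuple `g` is
`[e.repr (g i) l] * [ι (e l) j]`. [folklore] -/
theorem matrix_of_linearMap_eq_mul {R : Type*} [CommRing R] {M : Type*} [AddCommGroup M]
    [Module R M] {r : ℕ} (e : Module.Basis (Fin r) R M) (ι : M →ₗ[R] (Fin r → R))
    (g : Fin r → M) :
    (Matrix.of fun i j => ι (g i) j) =
      (Matrix.of fun i l => e.repr (g i) l) * Matrix.of fun l j => ι (e l) j := by
  ext i j
  simp only [Matrix.mul_apply, Matrix.of_apply]
  calc ι (g i) j = ι (∑ l, e.repr (g i) l • e l) j := by rw [e.sum_repr]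
    _ = ∑ l, e.repr (g i) l * ι (e l) j := by
      simp only [map_sum, map_smul, Finset.sum_apply, Pi.smul_apply, smul_eq_mul]

/-- If a finite free module `M` over a domain embeds in `R^r` and contains an `r`-tuple whose
image has non-zero determinant, then `finrank R M = r`. [folklore] -/
theorem finrank_eq_of_injective_of_det_ne_zero {R : Type*} [CommRing R] [IsDomain R]
    {M : Type*} [AddCommGroup M] [Module R M] [Module.Free R M] [Module.Finite R M] {r : ℕ}
    (ι : M →ₗ[R] (Fin r → R)) (hι : Function.Injective ι) (x : Fin r → M)
    (hx : (Matrix.of fun i j => ι (x i) j).det ≠ 0) : Module.finrank R M = r := by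
  apply le_antisymm
  · have hli := (Module.finBasis R M).linearIndependent.map' ι (LinearMap.ker_eq_bot.mpr hι)
    simpa using hli.fintype_card_le_finrank
  · have hli : LinearIndependent R (fun i => ι (x i)) :=
      Matrix.linearIndependent_rows_of_det_ne_zero hx
    have hli' : LinearIndependent R x := LinearIndependent.of_comp ι hli
    simpa using hli'.fintype_card_le_finrank

/-! ## The stage-wise facts -/

variable {k K : Type} [Field k] [Field K] [Algebra k K]

/-- For a regular local stage `B` the non-regular locus is empty, so `singIdeal B = ⊤`: every
localisation of a regular local ring at a prime ideal is regular (Serre).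
[cite: Matsumura1987, Thm. 19.3] -/
theorem singIdeal_eq_top_of_isRegularLocalRing (B : Subalgebra k K) [IsRegularLocalRing ↥B] :
    singIdeal B = ⊤ := by
  have h :
      {𝔭 : PrimeSpectrum ↥B | ¬ IsRegularLocalRing (Localization.AtPrime 𝔭.asIdeal)} = ∅ := by
    ext 𝔭
    simp only [Set.mem_setOf_eq, Set.mem_empty_iff_false, iff_false, not_not]
    exact isRegularLocalRing_localization_atPrime (↥B) 𝔭.asIdeal
  rw [singIdeal, h, Set.image_empty, sInf_empty]

/-- A stage `B` that is integrally closed with `K = Frac B` is its own normalisation: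
`nrm B = B`. [folklore] -/
theorem nrm_eq_self_of_isIntegrallyClosed (B : Subalgebra k K) [IsFractionRing ↥B K]
    [IsIntegrallyClosed ↥B] : nrm B = B := by
  have h : {y : K | IsIntegral ↥B y} = (B : Set K) := by
    ext y
    simp only [Set.mem_setOf_eq, SetLike.mem_coe]
    constructor
    · intro hy
      obtain ⟨b, rfl⟩ := IsIntegrallyClosed.isIntegral_iff.mp hy
      exact b.2
    · intro hy
      exact isIntegral_algebraMap (R := ↥B) (A := K) (x := ⟨y, hy⟩)
  rw [nrm, h, Algebra.adjoin_eq]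

/-- For a regular local stage `B` closed under localisation at the centre of `O`
(`locAt O B = B`), every Plücker ratio adjoined by the operator already lies in `B`:
`chartSet O B ⊆ B`. The resolved module `B ⧸ singIdeal B` is zero, so the syzygy module is
finite free of rank `r`; in a basis every maximal minor is `det [coords] * det [ι e]`, and
`O`-minimality makes the denominator `det [coords x]` an element of `B` inverted in `O`.
[cite: OnetoZatini1991, §1 (Nash transformation of a module)] -/
theorem chartSet_subset_of_isRegularLocalRing (O : ValuationSubring K) (B : Subalgebra k K)
    (hloc : locAt O B = B) [IsRegularLocalRing ↥B] : chartSet O B ⊆ (B : Set K) := by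
  haveI : IsDomain ↥B := isDomain_of_isRegularLocalRing ↥B
  rintro y ⟨b, d, ε, r, ι, -, hdε, hd, hι, -, g, x, hx, hmin, rfl⟩
  -- the resolved module `B ⧸ singIdeal B` is zero, so `d 0` is surjective
  haveI : Subsingleton (↥B ⧸ singIdeal B) :=
    Ideal.Quotient.subsingleton_iff.mpr (singIdeal_eq_top_of_isRegularLocalRing B)
  have h0 : LinearMap.range (d 0) = ⊤ := by
    rw [← hdε.linearMap_ker_eq, LinearMap.ker_eq_top]
    ext v
    exact Subsingleton.elim _ _
  -- the syzygy module is finite free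
  haveI : Module.Free ↥B ↥(LinearMap.range (d (syzygyIndex k K - 1))) :=
    free_range_of_exact b d h0 hd _
  -- the matrix of `x` over `B` has non-zero determinant, so the rank is `r`
  set φ : ↥B →+* K := algebraMap ↥B K
  have hXK : (Matrix.of fun i j => ((ι (x i) j : ↥B) : K)) =
      φ.mapMatrix (Matrix.of fun i j => ι (x i) j) := by
    ext i j; rfl
  have hdetX : (Matrix.of fun i j => ι (x i) j).det ≠ 0 := by
    intro h
    apply hx
    rw [hXK, ← RingHom.map_det, h, map_zero]
  have hrank : Module.finrank ↥B ↥(LinearMap.range (d (syzygyIndex k K - 1))) = r :=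
    finrank_eq_of_injective_of_det_ne_zero ι hι x hdetX
  obtain ⟨e⟩ :
      Nonempty (Module.Basis (Fin r) ↥B ↥(LinearMap.range (d (syzygyIndex k K - 1)))) :=
    ⟨Module.finBasisOfFinrankEq _ _ hrank⟩
  -- coordinate matrices and the matrix of the basis
  set E : Matrix (Fin r) (Fin r) ↥B := Matrix.of fun l j => ι (e l) j
  set Xc : Matrix (Fin r) (Fin r) ↥B := Matrix.of fun i l => e.repr (x i) l
  set Gc : Matrix (Fin r) (Fin r) ↥B := Matrix.of fun i l => e.repr (g i) l
  have hXf : (Matrix.of fun i j => ι (x i) j) = Xc * E := matrix_of_linearMap_eq_mul e ι x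
  have hGf : (Matrix.of fun i j => ι (g i) j) = Gc * E := matrix_of_linearMap_eq_mul e ι g
  -- determinants in `K`
  have hdx : (Matrix.of fun i j => ((ι (x i) j : ↥B) : K)).det = φ Xc.det * φ E.det := by
    rw [hXK, ← RingHom.map_det, hXf, Matrix.det_mul, map_mul]
  have hGK : (Matrix.of fun i j => ((ι (g i) j : ↥B) : K)) =
      φ.mapMatrix (Matrix.of fun i j => ι (g i) j) := by
    ext i j; rfl
  have hdg : (Matrix.of fun i j => ((ι (g i) j : ↥B) : K)).det = φ Gc.det * φ E.det := by
    rw [hGK, ← RingHom.map_det, hGf, Matrix.det_mul, map_mul]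
  have hEK : (Matrix.of fun i j => ((ι (e i) j : ↥B) : K)) = φ.mapMatrix E := by
    ext i j; rfl
  have hde : (Matrix.of fun i j => ((ι (e i) j : ↥B) : K)).det = φ E.det := by
    rw [hEK, ← RingHom.map_det]
  have hXc0 : φ Xc.det ≠ 0 := by
    intro h; apply hx; rw [hdx, h, zero_mul]
  have hE0 : φ E.det ≠ 0 := by
    intro h; apply hx; rw [hdx, h, mul_zero]
  -- `O`-minimality of `x` against the basis tuple `e`: `(det Xc)⁻¹ ∈ O`
  have hinvO : (φ Xc.det)⁻¹ ∈ O := by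
    have h := hmin (fun i => e i)
    rw [hde, hdx] at h
    have heq : φ E.det * (φ Xc.det * φ E.det)⁻¹ = (φ Xc.det)⁻¹ := by
      rw [mul_inv, mul_comm (φ Xc.det)⁻¹, ← mul_assoc, mul_inv_cancel₀ hE0,
        one_mul]
    rwa [heq] at h
  -- the ratio is `det Gc / det Xc`, an element of `locAt O B = B`
  have hy : (Matrix.of fun i j => ((ι (g i) j : ↥B) : K)).det *
      ((Matrix.of fun i j => ((ι (x i) j : ↥B) : K)).det)⁻¹ = φ Gc.det * (φ Xc.det)⁻¹ := by
    rw [hdg, hdx, mul_inv, mul_assoc, mul_comm (φ Xc.det)⁻¹, ← mul_assoc (φ E.det),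
      mul_inv_cancel₀ hE0, one_mul]
  have hmem : φ Gc.det * (φ Xc.det)⁻¹ ∈ locAt O B :=
    Algebra.subset_adjoin ⟨φ Gc.det, (Gc.det).2, φ Xc.det, (Xc.det).2, hinvO, rfl⟩
  rw [hloc] at hmem
  rw [SetLike.mem_coe, hy]
  exact hmem

/-- **Registered stub `stub_regularStep`** (crux stmt-ResolutionOfSingularities-17045, line
`birth`): regular stages are fixed points of the operator. For a stage `B ⊆ O` with
`Frac B = K`, closed under `locAt O` and regular local: `step O B = B`. All localisations of
`B` at primes are regular (Serre), so `singIdeal B = ⊤`, the resolved module is `0`, every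
syzygy module of an exact complex of finite free modules over a local ring is free, the
`O`-minimal maximal minors of a free rank-`r` submodule of `B^r` give ratios `b / u` with
`u ∈ B` an `O`-unit, i.e. elements of `locAt O B = B`; `nrm B = B` because a regular local ring
is integrally closed in its fraction field `K`; finally `locAt O B = B`.
[cite: Matsumura1987, Thm. 19.3 and Thm. 19.4] -/
theorem stub_regularStep : ∀ (k K : Type) [Field k] [Field K] [Algebra k K]
    (O : ValuationSubring K) (B : Subalgebra k K), (∀ c : k, algebraMap k K c ∈ O) →
      B.toSubring ≤ O.toSubring → IsFractionRing ↥B K → locAt O B = B → IsRegularLocalRing ↥B →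
      step O B = B := by
  intro k K _ _ _ O B _hk _hBO hFrac hloc hreg
  haveI := hFrac
  haveI := hreg
  haveI : IsIntegrallyClosed ↥B := isIntegrallyClosed_of_isRegularLocalRing ↥B
  have hchart : chart O B = B := by
    rw [chart_def,
      Set.union_eq_self_of_subset_right (chartSet_subset_of_isRegularLocalRing O B hloc),
      Algebra.adjoin_eq]
  rw [step_def, hchart, nrm_eq_self_of_isIntegrallyClosed B, hloc]

end Summit.ResolutionOfSingularities.ResolutionOfSingularities.Theorems.SyzygyFlattening

end
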